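import Summits.QuantumFields.YangMills.Theorems.FluctuationComparisonRegPrIntLHistoryPartition
import Summits.QuantumFields.YangMills.Theorems.FluctuationComparisonRegPrIntLWregGlue
import Literature.MathematicalPhysics.QuantumFieldTheory.Balaban1983to89.T3PrintedMinimiserExistence
import Literature.MathematicalPhysics.QuantumFieldTheory.Balaban1983to89.T3AvgDivergenceSplit
import Literature.MathematicalPhysics.QuantumFieldTheory.Balaban1983to89.T3ThresholdSmallness
import Literature.MathematicalPhysics.QuantumFieldTheory.Balaban1983to89.T3InteriorExcision
import Literature.MathematicalPhysics.QuantumFieldTheory.Balaban1983to89.T3DescentFibreTower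
import Literature.MathematicalPhysics.QuantumFieldTheory.Balaban1983to89.Node00.Record12MinimiserSelection
import Mathlib.MeasureTheory.Function.AEEqOfLIntegral
import HarnessLib

/-!
# S2β · THE CUT-OFF-HEIGHT LAYER `K = J` OF THE REGISTERED TABLE IS FREE
# (`FluctuationPartSmall`, 1L4ᶜ∘ `OneLoopClusteredIntCan`, H4ᶜ∘ `BeyondOneLoopSmallIntCan`, LFR♯ᶜ∘ `LargeFieldFourPtIntCan` ⟸ their `J < K` editions)

Cell `ym3-torus` (HUMAN RULING D-0037: rung R3 = continuum `SU(2)` Yang–Mills on `T³` — NOT `d = 4`, NOT infinite volume, NOT a mass gap, NOT the Clay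
problem); width seat `ym-ust-20520-w5` (gen 19); helper of the crux `stmt-QuantumFields-20520` `UnitScaleTilt.FluctuationComparisonRegPrIntL`
(`--supports … --as helper`, NOT a proof of it).  THEOREMS ONLY: 0 `def`, 0 `instance`, 0 `notation`, 0 `sorry`, default heartbeats.

CONTEXT.  The registered skeleton of record `Cruxes/FluctuationComparisonRegPrIntL/Lines/semiclassical_s2beta.lean` v11.4 (sha16 3732b7df) concludes the organ
S2β `FluctuationPartSmall` (:412) from the interior table {1L4ᶜ∘ :548, H4ᶜ∘ :571 = `stub_beyondOneLoopSmallIntCan`, LFR♯ᶜ∘ :588 = `stub_largeFieldFourPtIntCan`}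
(`fluctuationPartSmall_of_interiorTable`, PROVED there).  All four texts quantify `∀ (J K : ℕ) (hJK : J ≤ K)` — the run `K` read at the height `J` — and the S2 stage
of the run-pair organ consumes them at every `J ≤ K ≤ K′` (✓`…RunPairOrganSeedOfTables.runPairSeed_of_tables`), the DIAGONAL run `K = J` included.

THIS FILE shows that the diagonal layer `K = J` of each of the four texts is an IDENTITY `0 ≤ φ J · e^{−κ d}`, unconditionally, for `γ ≤ γ₁(L, b₀, p₀, ε₀)`:
on the run `K = J` no averaging separates datum and run — `ν K K` IS the Gibbs measure `Z_K⁻¹ e^{−β_K A} dV` (S2β's first `ν`-row), `fibre_{K,K}(V) = {V}`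
(✓`fibre_self`), and once `4·θBal(b₀)(K) < ε₀` every window datum is print-regular over itself (✓`regPr_of_plaqSmall`), so `minActionRegPr F K K _ ε₀ V = A(V)`
and the S2β integrand `log ρ + β_K · minActionRegPr` is the CONSTANT `−log Z_K` on the window; likewise `heightDensityCan F γ′ _ (histGood … K K) = e^{−β_K(γ′) A}`
pointwise on the interior window for every weight coupling `γ′ > 0` (✓`heightDensity_self_eq` of px20 g12 + `Node00.canonVersion_eqOn_of_continuousOn`), so the
λ-scaled fluctuation part `fluctAtCan λ` vanishes identically there, its semiclassical 4-point limit is `0`, and `log ρ − log heightDensityCan = −log Z_K`.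

* §1 `eqOn_gibbsDensity_of_withDensity_eq` — a continuous version `ρ` of the Gibbs measure on an OPEN set of fields IS `Z⁻¹ e^{−βA}` there, pointwise
  (`withDensity` is a.e.-injective on the restricted product Haar measure; product Haar on `SU(2)`-fields is open-positive, Mathlib `Measure.eqOn_open_of_ae_eq`).
* §2 `minActionRegPr_self_eq` — the diagonal minimum IS the datum's action (window datum, `θ ≤ ε₀`, `4θ < ε₀`).
* §3 ★`fourPt_fluctuationPart_self_eq_zero` and ★★`fluctuationPartSmall_diagonal` — the `K = J` layer of S2β's body is `= 0` for `γ ≤ γ₁(L,b₀,p₀,ε₀)`.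
* §4 ★★★`fluctuationPartSmall_of_offDiagonal : ⟨S2β's text with `(hJK : J < K)`⟩ → ⟨S2β `FluctuationPartSmall` :412 VERBATIM⟩`.
* §5 the canonical version on the diagonal: `heightDensityCan_self_eqOn`, `interiorWindow_subset_regSet_self`, `heightDensityCan_self_pos`.
* §6 ★★ the diagonal layers of the three ∘-rows and ★★★ the three doors `⟨row with J < K⟩ → ⟨registry row VERBATIM⟩` for 1L4ᶜ∘ ∕ H4ᶜ∘ ∕ LFR♯ᶜ∘
  (the Lines-local `fourPt` ∕ `fluctAtCan` ∕ `oneLoopFourPtCan` δ-UNFOLDED, `heightDensityCan` = its Theorems-side twin ✓`…WregGlue.heightDensityCan`, exactly as in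
  ✓`…S2BetaLaplaceKnit` §4; docking into the registry file is by `exact`).

NET (registry granularity, CREDITS NOTHING): hands on the `J < K` content of S2β ∕ stubs 4–5 ∕ 1L4ᶜ∘'s organs — and on the ideator's first-order re-cuts OSC¹∘ ∕ TAILSUP∘ ∕
CRUDELOC, which quantify the same `∀ J K (hJK : J ≤ K)` — may assume AT LEAST ONE averaging step.  A CONSISTENCY rung at the cut-off height in the sense of
✓`…HistoryPartition.largeFieldTerm_at_cutoff` (px20 g12), NOT a piece of Bałaban's 𝐑-operation.

HONEST SCOPE.  Elementary (measure-theoretic uniqueness of continuous densities + bookkeeping); nothing of the rows' `J < K` content (Laplace asymptotics of the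
constrained fluctuation integral, the two-loop remainder (45)–(47), the large-field 𝐑-operation), of EXW∘ ∕ GAP♯∘ ∕ DET-REP-B‴∘, of S2β, of the crux 20520, of EX ∕
19936 ∕ 19200 is proved or claimed; registry 20520 v11.4 0∕5 UNCHANGED; `YM3TorusSU2` NOT proved; the Yang–Mills mass gap (Clay) NOT proved.

References: [Balaban1985UV3] T. Bałaban, CMP 102 (1985) 255–275: (1)–(2) p.256 (`β_K`, the densities `ρ_k`), (7) p.257, (41) p.266 (the small-field term);
[Balaban1985Variational] CMP 102 (1985) 277–309: (2), (6) p.278 (print's regular space), Thm 1 (8) p.279; [Bogachev2007] V. I. Bogachev, Measure Theory I, Thm 2.5.3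
(a.e. uniqueness of densities).
-/

set_option autoImplicit false

noncomputable section

open MeasureTheory Filter Topology Set
open scoped ENNReal
open Literature.MathematicalPhysics.QuantumFieldTheory.Balaban1983to89
open Literature.MathematicalPhysics.QuantumFieldTheory.Balaban1983to89.T3ContinuumYM3Torus
open Literature.MathematicalPhysics.QuantumFieldTheory.Balaban1983to89.T3NestedUnitLaws
open Literature.MathematicalPhysics.QuantumFieldTheory.Balaban1983to89.T3UnitLawDensityEML
open Literature.MathematicalPhysics.QuantumFieldTheory.Balaban1983to89.T3UnitScaleTilt
open Literature.MathematicalPhysics.QuantumFieldTheory.Balaban1983to89.T3TiltDescent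
open Literature.MathematicalPhysics.QuantumFieldTheory.Balaban1983to89.T3PrintedRegularMinimiser
open Literature.MathematicalPhysics.QuantumFieldTheory.Balaban1983to89.T3PrintedMinimiserExistence
open Literature.MathematicalPhysics.QuantumFieldTheory.Balaban1983to89.T3ConstrainedMinimiser (fibre)
open Literature.MathematicalPhysics.QuantumFieldTheory.Balaban1983to89.T3LevelShift
open Literature.MathematicalPhysics.QuantumFieldTheory.Balaban1983to89.T3RegularMinimiser
open Literature.MathematicalPhysics.QuantumFieldTheory.Balaban1983to89.Missing
open Literature.MathematicalPhysics.QuantumFieldTheory.Balaban1983to89.T4Continuum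
open scoped Literature.MathematicalPhysics.QuantumFieldTheory.Balaban1983to89.T3OrbitAverage
open Summit.QuantumFields.YangMills.Theorems.FluctuationComparisonRegPrIntLWregGlue (heightDensityCan continuous_boltzmann)

namespace Summit.QuantumFields.YangMills.Theorems.FluctuationComparisonRegPrIntLS2BetaTableDiagonal

/-! ## §1 A continuous version of the Gibbs measure on an open set of fields IS `Z⁻¹ e^{−βA}` there -/

section Gibbs

variable (P : Params) {β : ℝ}

/-- **POINTWISE PINNING OF A CONTINUOUS VERSION OF THE GIBBS DENSITY**: if `Gibbs_β = dV.withDensity ρ` and `ρ` is continuous on an OPEN set `W` of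
`SU(2)`-fields, then `ρ = Z⁻¹·e^{−βA}` at EVERY point of `W` (`β ≥ 0`): restricted to `W` both are densities of the same finite measure against product Haar, hence
a.e. equal (Mathlib `withDensity_eq_iff_of_sigmaFinite`), and product Haar charges every non-empty open set (✓`isOpenPosMeasure_fieldMeasure_SU`), so the two
continuous functions agree on `W` (Mathlib `Measure.eqOn_open_of_ae_eq`). [cite: Bogachev2007, Thm 2.5.3; Balaban1985UV3, (1)-(2) p.256] -/
theorem eqOn_gibbsDensity_of_withDensity_eq (hβ : 0 ≤ β) {W : Set (GaugeField P 0 (Matrix.specialUnitaryGroup (Fin 2) ℂ))} (hW : IsOpen W)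
    {ρ : GaugeField P 0 (Matrix.specialUnitaryGroup (Fin 2) ℂ) → ℝ} (hρ : ContinuousOn ρ W)
    (h : T4GenFunBounds.gibbsMeasure (G := Matrix.specialUnitaryGroup (Fin 2) ℂ) P β =
      (fieldMeasure P 0 (Matrix.specialUnitaryGroup (Fin 2) ℂ)).withDensity fun U => ENNReal.ofReal (ρ U)) :
    EqOn ρ (fun U => (partitionFn (G := Matrix.specialUnitaryGroup (Fin 2) ℂ) P β)⁻¹ * boltzmann P β U) W := by
  set μ := fieldMeasure P 0 (Matrix.specialUnitaryGroup (Fin 2) ℂ) with hμ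
  set Z := partitionFn (G := Matrix.specialUnitaryGroup (Fin 2) ℂ) P β with hZdef
  haveI : IsProbabilityMeasure μ := isProbabilityMeasure_fieldMeasure (G := Matrix.specialUnitaryGroup (Fin 2) ℂ) P 0
  haveI := B12ContinuousTransportInvariance.isOpenPosMeasure_fieldMeasure_SU (N := 2) P 0
  have hZ : 0 < Z := partitionFn_pos' (G := Matrix.specialUnitaryGroup (Fin 2) ℂ) P hβ
  have hWm : MeasurableSet W := hW.measurableSet
  -- the Gibbs side, continuous everywhere
  have hgc : Continuous fun U : GaugeField P 0 (Matrix.specialUnitaryGroup (Fin 2) ℂ) => Z⁻¹ * boltzmann P β U :=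
    continuous_const.mul (continuous_boltzmann P β)
  -- both sides restricted to `W` as densities against `μ.restrict W`
  have h1 : (μ.restrict W).withDensity (fun U => ENNReal.ofReal (ρ U)) =
      (μ.restrict W).withDensity (fun U => ENNReal.ofReal (Z⁻¹ * boltzmann P β U)) := by
    have hr : (T4GenFunBounds.gibbsMeasure (G := Matrix.specialUnitaryGroup (Fin 2) ℂ) P β).restrict W =
        (μ.withDensity fun U => ENNReal.ofReal (ρ U)).restrict W := by rw [h]
    rw [restrict_withDensity hWm] at hr
    rw [← hr, T4GenFunBounds.gibbsMeasure, Measure.restrict_smul, restrict_withDensity hWm,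
      ← withDensity_smul' _ _ (ENNReal.inv_ne_top.mpr (ENNReal.ofReal_pos.mpr hZ).ne')]
    refine withDensity_congr_ae (Eventually.of_forall fun U => ?_)
    show (ENNReal.ofReal Z)⁻¹ * ENNReal.ofReal (boltzmann P β U) = ENNReal.ofReal (Z⁻¹ * boltzmann P β U)
    rw [ENNReal.ofReal_mul (inv_nonneg.mpr hZ.le), ENNReal.ofReal_inv_of_pos hZ]
  have hρm : AEMeasurable (fun U => ENNReal.ofReal (ρ U)) (μ.restrict W) :=
    ENNReal.measurable_ofReal.comp_aemeasurable (hρ.aemeasurable hWm)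
  have hgm : AEMeasurable (fun U => ENNReal.ofReal (Z⁻¹ * boltzmann P β U)) (μ.restrict W) :=
    (ENNReal.measurable_ofReal.comp hgc.measurable).aemeasurable
  have h2 : (fun U => ENNReal.ofReal (ρ U)) =ᵐ[μ.restrict W] (fun U => ENNReal.ofReal (Z⁻¹ * boltzmann P β U)) :=
    (withDensity_eq_iff_of_sigmaFinite hρm hgm).mp h1
  have h3 : ρ =ᵐ[μ.restrict W] (fun U => Z⁻¹ * boltzmann P β U) := by
    filter_upwards [h2] with U hU
    have hg : 0 < Z⁻¹ * boltzmann P β U := mul_pos (inv_pos.mpr hZ) (boltzmann_pos P β U)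
    rcases lt_or_ge (ρ U) 0 with hneg | hnn
    · rw [ENNReal.ofReal_of_nonpos hneg.le] at hU
      exact absurd hU.symm (ENNReal.ofReal_pos.mpr hg).ne'
    · exact (ENNReal.ofReal_eq_ofReal_iff hnn hg.le).mp hU
  exact Measure.eqOn_open_of_ae_eq h3 hW hρ hgc.continuousOn

/-- Hence on `W`: `log ρ = −log Z − β·A` (both factors positive). [cite: Balaban1985UV3, (1)-(2) p.256] -/
theorem log_version_eq_of_withDensity_eq (hβ : 0 ≤ β) {W : Set (GaugeField P 0 (Matrix.specialUnitaryGroup (Fin 2) ℂ))} (hW : IsOpen W)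
    {ρ : GaugeField P 0 (Matrix.specialUnitaryGroup (Fin 2) ℂ) → ℝ} (hρ : ContinuousOn ρ W)
    (h : T4GenFunBounds.gibbsMeasure (G := Matrix.specialUnitaryGroup (Fin 2) ℂ) P β =
      (fieldMeasure P 0 (Matrix.specialUnitaryGroup (Fin 2) ℂ)).withDensity fun U => ENNReal.ofReal (ρ U))
    {U : GaugeField P 0 (Matrix.specialUnitaryGroup (Fin 2) ℂ)} (hU : U ∈ W) :
    Real.log (ρ U) = -Real.log (partitionFn (G := Matrix.specialUnitaryGroup (Fin 2) ℂ) P β) - β * wilsonAction4 U := by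
  have hZ : 0 < partitionFn (G := Matrix.specialUnitaryGroup (Fin 2) ℂ) P β := partitionFn_pos' _ hβ
  rw [eqOn_gibbsDensity_of_withDensity_eq P hβ hW hρ h hU]
  show Real.log ((partitionFn (G := Matrix.specialUnitaryGroup (Fin 2) ℂ) P β)⁻¹ * boltzmann P β U) = _
  rw [Real.log_mul (inv_ne_zero hZ.ne') (boltzmann_pos P β U).ne', Real.log_inv, boltzmann, Real.log_exp]
  ring

end Gibbs

/-! ## §2 On the diagonal the print-regular minimum IS the datum's action -/

section Diagonal

variable (F : T3Family)

/-- **`minActionRegPr F K K _ ε₀ V = A(V)` FOR A WINDOW DATUM** (`PlaqSmall θ V`, `θ ≤ ε₀`, `4θ < ε₀`): the fibre over `V` at depth `0` is `{V}` (✓`fibre_self`) and `V`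
satisfies both clauses of print's (2) at the thresholds `ε₀·L⁰ = ε₀` (✓`regPr_of_plaqSmall`), so `V` is its own print-regular minimiser.
[cite: Balaban1985Variational, (2) and (6) p.278, Thm 1 (8) p.279] -/
theorem minActionRegPr_self_eq {K : ℕ} (hKK : K ≤ K) {ε₀ θ : ℝ} (hθε : θ ≤ ε₀) (h4 : 4 * θ < ε₀)
    {V : GaugeField (F.P K) 0 (Matrix.specialUnitaryGroup (Fin 2) ℂ)} (hV : PlaqSmall θ V) :
    minActionRegPr F K K hKK ε₀ V = wilsonAction4 V := by
  have hreg : RegPr F K K ε₀ V := by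
    refine T3AvgDivergenceSplit.regPr_of_plaqSmall F hV ?_ ?_
    · show θ ≤ ε₀ * ((F.L : ℝ)⁻¹) ^ (2 * (K - K))
      rw [Nat.sub_self, mul_zero, pow_zero, mul_one]
      exact hθε
    · rw [Nat.sub_self, mul_zero, pow_zero, mul_one]
      exact h4
  have hfib : fibre F ℰp K K hKK V = {V} := T3DescentFibreTower.fibre_self F ℰp K V
  have hmem : V ∈ regFibrePr F K K hKK ε₀ V := (mem_regFibrePr_iff F).mpr ⟨by rw [hfib]; rfl, hreg⟩
  refine (minActionRegPr_eq_of_isMinOn F hmem fun W hW => ?_).symm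
  have hWV : W = V := by
    have h := ((mem_regFibrePr_iff F).mp hW).1
    rwa [hfib] at h
  show wilsonAction4 V ≤ wilsonAction4 W
  rw [hWV]

/-- The window at a shrunken profile lies in the window (`0 < γ ≤ 1`, `0 < b₀`, `c ≤ 1`). [cite: Balaban1985UV3, (7) p.257] -/
theorem plaqSmall_of_interior {γ b₀ c : ℝ} (hγ : 0 < γ) (hγ1 : γ ≤ 1) (hb : 0 < b₀) (hc1 : c ≤ 1) (p₀ : ℝ) (J : ℕ)
    {V : GaugeField (F.P J) 0 (Matrix.specialUnitaryGroup (Fin 2) ℂ)} (hV : PlaqSmall (θBal F.L γ (c * b₀) p₀ J) V) :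
    PlaqSmall (θBal F.L γ b₀ p₀ J) V :=
  plaqSmall_of_le (T3InteriorExcision.θBal_mul_le F.hL.2.le hγ hγ1 hb hc1 p₀ J) hV

/-- **THE COUPLING THRESHOLD OF THE DIAGONAL**: for `γ ≤ γ₁(L, b₀, p₀, ε₀)` (`γ₁ ≤ 1`), `θBal L γ b₀ p₀ i ≤ ε₀/5` at EVERY height `i` — so `θ ≤ ε₀` and `4θ < ε₀`
for every window radius `θ = θBal(c·b₀)(i)`, `c ≤ 1`. [cite: Balaban1985Variational, Thm 1 p.279; Balaban1985UV3, (7) p.257] -/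
theorem exists_gamma_diagonal {L : ℕ} (hL : 1 ≤ L) (b₀ p₀ : ℝ) {ε₀ : ℝ} (hε₀ : 0 < ε₀) :
    ∃ γ₁ : ℝ, 0 < γ₁ ∧ γ₁ ≤ 1 ∧ ∀ γ : ℝ, 0 < γ → γ ≤ γ₁ → ∀ i : ℕ, θBal L γ b₀ p₀ i ≤ ε₀ ∧ 4 * θBal L γ b₀ p₀ i < ε₀ := by
  obtain ⟨γ₁, hγ₁, H⟩ := T3ThresholdSmallness.exists_forall_θBal_le hL b₀ p₀ (show 0 < ε₀ / 5 by positivity)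
  refine ⟨min γ₁ 1, lt_min hγ₁ one_pos, min_le_right _ _, fun γ hγ hγle i => ?_⟩
  have h := H γ hγ (hγle.trans (min_le_left _ _)) i
  exact ⟨by linarith, by linarith⟩

end Diagonal

/-! ## §3 The diagonal layer of S2β's body vanishes -/

section S2Beta

variable (F : T3Family)

/-- ★ **THE 4-POINT OF `log ρ + β_K · minActionRegPr_{K,K}` VANISHES AT EVERY WINDOW QUADRILATERAL ON THE DIAGONAL**: with `ν K K = Gibbs_K = dV.withDensity ρ`, `ρ`
continuous on the (open) window of radius `θ` with `θ ≤ ε₀`, `4θ < ε₀`, the integrand is the constant `−log Z_K` on the window. [cite: Balaban1985UV3, (2) p.256 and (41) p.266] -/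
theorem fourPt_fluctuationPart_self_eq_zero {γ : ℝ} (hγ : 0 ≤ γ) {K : ℕ} (hKK : K ≤ K) {ε₀ θ : ℝ} (hθε : θ ≤ ε₀) (h4 : 4 * θ < ε₀)
    {ρ : GaugeField (F.P K) 0 (Matrix.specialUnitaryGroup (Fin 2) ℂ) → ℝ}
    (hν : T4GenFunBounds.gibbsMeasure (G := Matrix.specialUnitaryGroup (Fin 2) ℂ) (F.P K) ((F.scheme ℰp γ).β K) =
      (fieldMeasure (F.P K) 0 (Matrix.specialUnitaryGroup (Fin 2) ℂ)).withDensity fun U => ENNReal.ofReal (ρ U))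
    (hρ : ContinuousOn ρ {U | PlaqSmall θ U})
    {U V W Z : GaugeField (F.P K) 0 (Matrix.specialUnitaryGroup (Fin 2) ℂ)}
    (hU : PlaqSmall θ U) (hV : PlaqSmall θ V) (hW : PlaqSmall θ W) (hZ : PlaqSmall θ Z) :
    ((Real.log (ρ U) + (F.scheme ℰp γ).β K * minActionRegPr F K K hKK ε₀ U)
        - (Real.log (ρ V) + (F.scheme ℰp γ).β K * minActionRegPr F K K hKK ε₀ V))
      - ((Real.log (ρ W) + (F.scheme ℰp γ).β K * minActionRegPr F K K hKK ε₀ W)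
        - (Real.log (ρ Z) + (F.scheme ℰp γ).β K * minActionRegPr F K K hKK ε₀ Z)) = 0 := by
  have hβ : 0 ≤ (F.scheme ℰp γ).β K := F.scheme_β_nonneg ℰp hγ K
  have hopen : IsOpen {U : GaugeField (F.P K) 0 (Matrix.specialUnitaryGroup (Fin 2) ℂ) | PlaqSmall θ U} := Node00.isOpen_plaqSmall θ
  have hconst : ∀ {X : GaugeField (F.P K) 0 (Matrix.specialUnitaryGroup (Fin 2) ℂ)}, PlaqSmall θ X →
      Real.log (ρ X) + (F.scheme ℰp γ).β K * minActionRegPr F K K hKK ε₀ X =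
        -Real.log (partitionFn (G := Matrix.specialUnitaryGroup (Fin 2) ℂ) (F.P K) ((F.scheme ℰp γ).β K)) := by
    intro X hX
    rw [log_version_eq_of_withDensity_eq (F.P K) hβ hopen hρ hν hX, minActionRegPr_self_eq F hKK hθε h4 hX]
    ring
  rw [hconst hU, hconst hV, hconst hW, hconst hZ]
  ring

/-- ★★ **THE DIAGONAL LAYER OF S2β `FluctuationPartSmall`** (registry v11.4 :412, its body at `J = K`): for every block size, profile and `ε₀ > 0` there is
`γ₁ > 0` such that for every family, coupling `γ ≤ γ₁`, nested laws `ν` with `ν K K = Gibbs_K` (S2β's first `ν`-row; the second is not needed), every run `K`, every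
admissible version `ρ` at height `J = K` (S2β's three `ρ`-rows) and every window quadrilateral, S2β's 4-point is `0`. [cite: Balaban1985UV3, (2) p.256 and (41) p.266] -/
theorem fluctuationPartSmall_diagonal (L : ℕ) (b₀ p₀ ε₀ : ℝ) (hε₀ : 0 < ε₀) :
    ∃ γ₁ : ℝ, 0 < γ₁ ∧ ∀ (F : T3Family) (γ : ℝ), F.L = L → 0 < γ → γ ≤ γ₁ →
      ∀ (ν : ℕ → (j : ℕ) → Measure (GaugeField (F.P j) 0 (Matrix.specialUnitaryGroup (Fin 2) ℂ))),
        (∀ K, ν K K = T4GenFunBounds.gibbsMeasure (F.P K) ((F.scheme ℰp γ).β K)) →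
        ∀ (K : ℕ) (hKK : K ≤ K) (ρ : GaugeField (F.P K) 0 (Matrix.specialUnitaryGroup (Fin 2) ℂ) → ℝ),
          (∀ U, PlaqSmall (θBal F.L γ b₀ p₀ K) U → 0 < ρ U) →
          ν K K = (fieldMeasure _ _ _).withDensity (fun U => ENNReal.ofReal (ρ U)) →
          ContinuousOn ρ {U | PlaqSmall (θBal F.L γ b₀ p₀ K) U} →
          ∀ (b b' : PBond (F.P K) 0) (U V W Z : GaugeField (F.P K) 0 (Matrix.specialUnitaryGroup (Fin 2) ℂ)),
            PlaqSmall (θBal F.L γ b₀ p₀ K) U → PlaqSmall (θBal F.L γ b₀ p₀ K) V →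
            PlaqSmall (θBal F.L γ b₀ p₀ K) W → PlaqSmall (θBal F.L γ b₀ p₀ K) Z →
            (∀ e, e ≠ b → U e = V e) → (∀ e, e ≠ b' → U e = W e) → (∀ e, e ≠ b' → V e = Z e) → (∀ e, e ≠ b → W e = Z e) →
            ((Real.log (ρ U) + (F.scheme ℰp γ).β K * minActionRegPr F K K hKK ε₀ U)
                - (Real.log (ρ V) + (F.scheme ℰp γ).β K * minActionRegPr F K K hKK ε₀ V))
              - ((Real.log (ρ W) + (F.scheme ℰp γ).β K * minActionRegPr F K K hKK ε₀ W)
                - (Real.log (ρ Z) + (F.scheme ℰp γ).β K * minActionRegPr F K K hKK ε₀ Z)) = 0 := by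
  by_cases hL : 1 ≤ L
  · obtain ⟨γ₁, hγ₁, -, H⟩ := exists_gamma_diagonal hL b₀ p₀ hε₀
    refine ⟨γ₁, hγ₁, fun F γ hFL hγ hγle ν hνK K hKK ρ _ hνρ hρc b b' U V W Z hU hV hW hZ _ _ _ _ => ?_⟩
    obtain ⟨hθε, h4⟩ := H γ hγ hγle K
    rw [← hFL] at hθε h4
    exact fourPt_fluctuationPart_self_eq_zero F hγ.le hKK hθε h4 ((hνK K).symm.trans hνρ) hρc hU hV hW hZ
  · -- no family has block size `L < 1`
    refine ⟨1, one_pos, fun F γ hFL => ?_⟩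
    exact absurd (hFL ▸ F.hL.2.le : 1 ≤ L) hL

end S2Beta

/-! ## §4 THE DOOR: S2β from its off-diagonal (`J < K`) edition -/

section Door

/-- ★★★ **S2β `FluctuationPartSmall` (registry `Lines/semiclassical_s2beta.lean` v11.4 :412, VERBATIM) FROM ITS OFF-DIAGONAL EDITION** — the same text with
`(hJK : J ≤ K)` replaced by `(hJK : J < K)` (and `hJK.le` feeding `minActionRegPr`): thresholds `pS, ε₁, κ, φ` unchanged, `γ₁ := min γ₁ γ₁^{diag}(L, b₀, p₀, ε₀)`; at
`J < K` the hypothesis, at `J = K` §3 (`0 ≤ φ J · e^{−κ d}`). [cite: Balaban1985UV3, Thm 2 p.263 and (41) p.266] -/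
theorem fluctuationPartSmall_of_offDiagonal
    (h : ∀ (L : ℕ), ∃ pS : ℝ, ∀ (b₀ p₀ : ℝ), 0 < b₀ → pS ≤ p₀ → 0 < p₀ → ∃ ε₁ : ℝ, 0 < ε₁ ∧ ∀ (ε₀ : ℝ), 0 < ε₀ → ε₀ ≤ ε₁ →
      ∃ γ₁ : ℝ, 0 < γ₁ ∧ ∃ κ : ℝ, 0 < κ ∧ ∀ (F : T3Family) (γ : ℝ), F.L = L → 0 < γ → γ ≤ γ₁ →
        ∃ (φ : ℕ → ℝ), (∀ J, 0 ≤ φ J) ∧ Tendsto (fun J : ℕ => (J : ℝ) * φ J) atTop (𝓝 0) ∧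
          ∀ (ν : ℕ → (j : ℕ) → Measure (GaugeField (F.P j) 0 (Matrix.specialUnitaryGroup (Fin 2) ℂ))),
            (∀ K, ν K K = T4GenFunBounds.gibbsMeasure (F.P K) ((F.scheme ℰp γ).β K)) →
            (∀ K j, j < K → ν K j = Measure.map (descend F ℰp j) (ν K (j + 1))) →
            ∀ (J K : ℕ) (hJK : J < K) (ρ : GaugeField (F.P J) 0 (Matrix.specialUnitaryGroup (Fin 2) ℂ) → ℝ),
              (∀ U, PlaqSmall (θBal F.L γ b₀ p₀ J) U → 0 < ρ U) →
              ν K J = (fieldMeasure _ _ _).withDensity (fun U => ENNReal.ofReal (ρ U)) →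
              ContinuousOn ρ {U | PlaqSmall (θBal F.L γ b₀ p₀ J) U} →
              ∀ (b b' : PBond (F.P J) 0) (U V W Z : GaugeField (F.P J) 0 (Matrix.specialUnitaryGroup (Fin 2) ℂ)),
                PlaqSmall (θBal F.L γ b₀ p₀ J) U → PlaqSmall (θBal F.L γ b₀ p₀ J) V →
                PlaqSmall (θBal F.L γ b₀ p₀ J) W → PlaqSmall (θBal F.L γ b₀ p₀ J) Z →
                (∀ e, e ≠ b → U e = V e) → (∀ e, e ≠ b' → U e = W e) → (∀ e, e ≠ b' → V e = Z e) → (∀ e, e ≠ b → W e = Z e) →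
                |((Real.log (ρ U) + (F.scheme ℰp γ).β K * minActionRegPr F J K hJK.le ε₀ U)
                    - (Real.log (ρ V) + (F.scheme ℰp γ).β K * minActionRegPr F J K hJK.le ε₀ V))
                  - ((Real.log (ρ W) + (F.scheme ℰp γ).β K * minActionRegPr F J K hJK.le ε₀ W)
                    - (Real.log (ρ Z) + (F.scheme ℰp γ).β K * minActionRegPr F J K hJK.le ε₀ Z))|
                  ≤ φ J * Real.exp (-(κ * (b.src.tdist b'.src : ℝ)))) :
    ∀ (L : ℕ), ∃ pS : ℝ, ∀ (b₀ p₀ : ℝ), 0 < b₀ → pS ≤ p₀ → 0 < p₀ → ∃ ε₁ : ℝ, 0 < ε₁ ∧ ∀ (ε₀ : ℝ), 0 < ε₀ → ε₀ ≤ ε₁ →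
      ∃ γ₁ : ℝ, 0 < γ₁ ∧ ∃ κ : ℝ, 0 < κ ∧ ∀ (F : T3Family) (γ : ℝ), F.L = L → 0 < γ → γ ≤ γ₁ →
        ∃ (φ : ℕ → ℝ), (∀ J, 0 ≤ φ J) ∧ Tendsto (fun J : ℕ => (J : ℝ) * φ J) atTop (𝓝 0) ∧
          ∀ (ν : ℕ → (j : ℕ) → Measure (GaugeField (F.P j) 0 (Matrix.specialUnitaryGroup (Fin 2) ℂ))),
            (∀ K, ν K K = T4GenFunBounds.gibbsMeasure (F.P K) ((F.scheme ℰp γ).β K)) →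
            (∀ K j, j < K → ν K j = Measure.map (descend F ℰp j) (ν K (j + 1))) →
            ∀ (J K : ℕ) (hJK : J ≤ K) (ρ : GaugeField (F.P J) 0 (Matrix.specialUnitaryGroup (Fin 2) ℂ) → ℝ),
              (∀ U, PlaqSmall (θBal F.L γ b₀ p₀ J) U → 0 < ρ U) →
              ν K J = (fieldMeasure _ _ _).withDensity (fun U => ENNReal.ofReal (ρ U)) →
              ContinuousOn ρ {U | PlaqSmall (θBal F.L γ b₀ p₀ J) U} →
              ∀ (b b' : PBond (F.P J) 0) (U V W Z : GaugeField (F.P J) 0 (Matrix.specialUnitaryGroup (Fin 2) ℂ)),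
                PlaqSmall (θBal F.L γ b₀ p₀ J) U → PlaqSmall (θBal F.L γ b₀ p₀ J) V →
                PlaqSmall (θBal F.L γ b₀ p₀ J) W → PlaqSmall (θBal F.L γ b₀ p₀ J) Z →
                (∀ e, e ≠ b → U e = V e) → (∀ e, e ≠ b' → U e = W e) → (∀ e, e ≠ b' → V e = Z e) → (∀ e, e ≠ b → W e = Z e) →
                |((Real.log (ρ U) + (F.scheme ℰp γ).β K * minActionRegPr F J K hJK ε₀ U)
                    - (Real.log (ρ V) + (F.scheme ℰp γ).β K * minActionRegPr F J K hJK ε₀ V))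
                  - ((Real.log (ρ W) + (F.scheme ℰp γ).β K * minActionRegPr F J K hJK ε₀ W)
                    - (Real.log (ρ Z) + (F.scheme ℰp γ).β K * minActionRegPr F J K hJK ε₀ Z))|
                  ≤ φ J * Real.exp (-(κ * (b.src.tdist b'.src : ℝ))) := by
  intro L
  obtain ⟨pS, H⟩ := h L
  refine ⟨pS, fun b₀ p₀ hb hpS hp => ?_⟩
  obtain ⟨ε₁, hε₁, H⟩ := H b₀ p₀ hb hpS hp
  refine ⟨ε₁, hε₁, fun ε₀ hε₀ hε₀1 => ?_⟩
  obtain ⟨γ₁, hγ₁, κ, hκ, H⟩ := H ε₀ hε₀ hε₀1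
  obtain ⟨γd, hγd, Hd⟩ := fluctuationPartSmall_diagonal L b₀ p₀ ε₀ hε₀
  refine ⟨min γ₁ γd, lt_min hγ₁ hγd, κ, hκ, fun F γ hFL hγ hγle => ?_⟩
  obtain ⟨φ, hφ0, hφt, H⟩ := H F γ hFL hγ (hγle.trans (min_le_left _ _))
  refine ⟨φ, hφ0, hφt, fun ν hνK hνd J K hJK ρ hρpos hνρ hρc b b' U V W Z hU hV hW hZ hUV hUW hVZ hWZ => ?_⟩
  rcases eq_or_lt_of_le hJK with hJKeq | hJKlt
  · subst hJKeq
    rw [Hd F γ hFL hγ (hγle.trans (min_le_right _ _)) ν hνK J hJK ρ hρpos hνρ hρc b b' U V W Z hU hV hW hZ hUV hUW hVZ hWZ, abs_zero]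
    exact mul_nonneg (hφ0 J) (Real.exp_pos _).le
  · exact H ν hνK hνd J K hJKlt ρ hρpos hνρ hρc b b' U V W Z hU hV hW hZ hUV hUW hVZ hWZ

end Door

end Summit.QuantumFields.YangMills.Theorems.FluctuationComparisonRegPrIntLS2BetaTableDiagonal

end
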